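import Mathlib
import Literature.Analysis.ODE.ConstCoeffL2Vanishing
import Summits.NavierStokesRegularity.NavierStokesRegularity.Theorems.EulerZoomLiouvillePowerGaugeEulerLiouvilleNeedleAnnulusCapacity

/-!
# CIRCULAR MEANS AND PLANAR DIRICHLET ENERGY — tools for plate t46-F «FilamentCapacity» (nsreg-p2 g34, ROUND-44 LEMMA F)

Width piece for crux `EulerZoomLiouville.PowerGaugeEulerLiouville` (stmt-NavierStokesRegularity-19832), by name under
LEAD 19832 (ns-typeII-p2 g13); seat ns-sfl-p1 g6, `--supports stmt-NavierStokesRegularity-19832 --as helper`.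
Self-contained plane calculus (no flow, no profile), continuing the t42b annulus-capacity file
(`…NeedleAnnulusCapacity`: `annulusIntegral_eq_integral_polar`, `hasDerivAt_comp_ray`,
`sq_integral_le_log_mul_integral_mul_sq`) with the CIRCULAR-MEAN versions that LEMMA F needs:

* `annulusIntegral_eq_integral_circleMap` / `annulusIntegral_eq_integral_mul_circleAverage` — the annulus integral of a
  continuous `F` as `∫_0^{2π} ∫_w^r ρ F(ρe^{iθ}) dρ dθ` and as `2π ∫_w^r ρ · ⨍_{S_ρ} F dρ` (`Real.circleAverage`);
* `abs_sub_le_integral_norm_fderiv_ray'`, `abs_sub_le_integral_norm_fderiv_arc` — fundamental theorem of calculus along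
  rays and along arcs of circles;
* `annulusEnergy_ge_circleAverage_amplitude` — the MEAN capacity count
  `2π (m(w) − m(r))² / log(r/w) ≤ ∫_{w ≤ ‖z‖ ≤ r} ‖Dψ‖²`, `m(ρ) = ⨍_{S_ρ} ψ` (Cauchy–Schwarz in the angle is the tree's
  `Literature.Analysis.ODE.sq_intervalIntegral_le`);
* `circleEnergy_ge_of_two_values` — the oscillation count on one circle: two values differing by `D` force
  `2D²/(πρ) ≤ ρ ∫_0^{2π} ‖Dψ(ρe^{iθ})‖² dθ`.

HONEST FRAMING: plane calculus; proves nothing about the crux E (19832 OPEN), any door Target, or Navier–Stokes regularity;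
no summit statement is touched. [folklore (logarithmic capacity; Cauchy–Schwarz on circles)]
-/

noncomputable section

open Set Filter Topology Metric Function MeasureTheory intervalIntegral Complex
open scoped Real NNReal ENNReal

set_option linter.dupNamespace false

namespace Summit.NavierStokesRegularity.NavierStokesRegularity.Theorems.PowerGaugeEulerLiouville.Condenser

/-! ## §1 Circles, rays, and the annulus integral through circular means -/

/-- `circleMap 0 ρ θ = ρ e^{iθ}` written as the polar-coordinate ray point `ρ (cos θ + i sin θ)`. [folklore] -/
theorem circleMap_zero_eq_ray (ρ θ : ℝ) :
    circleMap 0 ρ θ = (ρ : ℂ) * ((Real.cos θ : ℂ) + (Real.sin θ : ℂ) * I) := by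
  simp [circleMap_zero, Complex.exp_mul_I]

/-- A point of norm `ρ` is `circleMap 0 ρ θ` for `θ = arg z`. [folklore] -/
theorem exists_circleMap_zero_eq {z : ℂ} {ρ : ℝ} (hz : ‖z‖ = ρ) : ∃ θ : ℝ, circleMap 0 ρ θ = z :=
  ⟨Complex.arg z, by rw [circleMap_zero, ← hz]; exact Complex.norm_mul_exp_arg_mul_I z⟩

/-- **The annulus integral in polar coordinates, angle outside over a full period.**  For a continuous
`F : ℂ → ℝ` and `0 < w ≤ r`: `∫_{w ≤ ‖z‖ ≤ r} F = ∫_0^{2π} ∫_w^r ρ · F(circleMap 0 ρ θ) dρ dθ`. [folklore] -/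
theorem annulusIntegral_eq_integral_circleMap {F : ℂ → ℝ} (hF : Continuous F) {w r : ℝ} (hw : 0 < w)
    (hwr : w ≤ r) :
    ∫ z in {z : ℂ | w ≤ ‖z‖ ∧ ‖z‖ ≤ r}, F z =
      ∫ θ in (0 : ℝ)..2 * π, ∫ ρ in w..r, ρ * F (circleMap 0 ρ θ) := by
  rw [annulusIntegral_eq_integral_polar hF hw hwr]
  set g : ℝ → ℝ := fun θ => ∫ ρ in w..r, ρ * F (circleMap 0 ρ θ) with hg
  have hgeq : (fun θ : ℝ => ∫ ρ in w..r, ρ * F ((ρ : ℂ) * ((Real.cos θ : ℂ) + (Real.sin θ : ℂ) * I))) = g := by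
    funext θ
    simp only [hg, circleMap_zero_eq_ray]
  have hper : Periodic g (2 * π) := by
    intro θ
    simp only [hg]
    refine intervalIntegral.integral_congr fun ρ _ => ?_
    rw [(periodic_circleMap 0 ρ) θ]
  rw [hgeq]
  change ∫ θ in Ioo (-π) π, g θ = ∫ θ in (0 : ℝ)..2 * π, g θ
  rw [← integral_Ioc_eq_integral_Ioo, ← intervalIntegral.integral_of_le (by linarith [Real.pi_pos])]
  have h := hper.intervalIntegral_add_eq (-π) 0
  rw [zero_add, show -π + 2 * π = π by ring] at h
  exact h

/-- **The annulus integral through circular means.**  For a continuous `F : ℂ → ℝ` and `0 < w ≤ r`: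
`∫_{w ≤ ‖z‖ ≤ r} F = 2π ∫_w^r ρ · (⨍_{‖z‖ = ρ} F) dρ` with Mathlib's `Real.circleAverage`. [folklore] -/
theorem annulusIntegral_eq_integral_mul_circleAverage {F : ℂ → ℝ} (hF : Continuous F) {w r : ℝ} (hw : 0 < w)
    (hwr : w ≤ r) :
    ∫ z in {z : ℂ | w ≤ ‖z‖ ∧ ‖z‖ ≤ r}, F z =
      2 * π * ∫ ρ in w..r, ρ * Real.circleAverage F 0 ρ := by
  rw [annulusIntegral_eq_integral_circleMap hF hw hwr]
  have h2π : (0 : ℝ) ≤ 2 * π := by linarith [Real.pi_pos]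
  -- the integrand as a function of two variables
  set f : ℝ → ℝ → ℝ := fun θ ρ => ρ * F (circleMap 0 ρ θ) with hf
  have hfc : Continuous (uncurry f) := by
    have h1 : Continuous fun p : ℝ × ℝ => circleMap 0 p.2 p.1 := by
      unfold circleMap; fun_prop
    exact continuous_snd.mul (hF.comp h1)
  have hfi : Integrable (uncurry f) ((volume.restrict (Ioc 0 (2 * π))).prod (volume.restrict (Ioc w r))) := by
    rw [Measure.prod_restrict]
    exact (hfc.continuousOn.integrableOn_compact (isCompact_Icc.prod isCompact_Icc)).mono_set
      (prod_mono Ioc_subset_Icc_self Ioc_subset_Icc_self)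
  have hswap := integral_integral_swap hfi
  -- rewrite both sides as iterated set integrals
  rw [intervalIntegral.integral_of_le h2π]
  have hL : ∫ θ in Ioc 0 (2 * π), ∫ ρ in w..r, ρ * F (circleMap 0 ρ θ) =
      ∫ θ in Ioc 0 (2 * π), ∫ ρ in Ioc w r, f θ ρ := by
    refine setIntegral_congr_fun measurableSet_Ioc fun θ _ => ?_
    rw [intervalIntegral.integral_of_le hwr]
  rw [hL, hswap, intervalIntegral.integral_of_le hwr, ← MeasureTheory.integral_const_mul]
  refine setIntegral_congr_fun measurableSet_Ioc fun ρ _ => ?_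
  simp only [hf]
  rw [MeasureTheory.integral_const_mul, Real.circleAverage_def, smul_eq_mul,
    ← intervalIntegral.integral_of_le h2π]
  have hπ : (2 : ℝ) * π ≠ 0 := by positivity
  field_simp

/-! ## §2 The fundamental theorem of calculus along rays and arcs -/

/-- FTC along a ray, two-sided: `|ψ(r e^{iθ}) − ψ(w e^{iθ})| ≤ ∫_w^r ‖Dψ(ρ e^{iθ})‖ dρ` for `w ≤ r`. [folklore] -/
theorem abs_sub_le_integral_norm_fderiv_ray' {ψ : ℂ → ℝ} (hψ : ContDiff ℝ 1 ψ) {w r : ℝ} (hwr : w ≤ r)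
    (θ : ℝ) :
    |ψ (circleMap 0 r θ) - ψ (circleMap 0 w θ)| ≤ ∫ ρ in w..r, ‖fderiv ℝ ψ (circleMap 0 ρ θ)‖ := by
  simp only [circleMap_zero_eq_ray]
  set e : ℂ := (Real.cos θ : ℂ) + (Real.sin θ : ℂ) * I with he
  set g : ℝ → ℝ := fun ρ => ψ ((ρ : ℂ) * e) with hg
  set g' : ℝ → ℝ := fun ρ => fderiv ℝ ψ ((ρ : ℂ) * e) e with hg'
  have hψd : Differentiable ℝ ψ := hψ.differentiable one_ne_zero
  have hderiv : ∀ ρ, HasDerivAt g (g' ρ) ρ := fun ρ => hasDerivAt_comp_ray hψd θ ρ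
  have hrayc : Continuous fun ρ : ℝ => (ρ : ℂ) * e := continuous_ofReal.mul continuous_const
  have hDc : Continuous fun ρ : ℝ => fderiv ℝ ψ ((ρ : ℂ) * e) := (hψ.continuous_fderiv one_ne_zero).comp hrayc
  have hg'c : Continuous g' := hDc.clm_apply continuous_const
  have hNc : Continuous fun ρ : ℝ => ‖fderiv ℝ ψ ((ρ : ℂ) * e)‖ := hDc.norm
  have hftc : ∫ ρ in w..r, g' ρ = g r - g w :=
    integral_eq_sub_of_hasDerivAt (fun ρ _ => hderiv ρ) (hg'c.intervalIntegrable _ _)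
  have hbound : ∀ ρ, |g' ρ| ≤ ‖fderiv ℝ ψ ((ρ : ℂ) * e)‖ := by
    intro ρ
    rw [hg', ← Real.norm_eq_abs]
    calc ‖fderiv ℝ ψ ((ρ : ℂ) * e) e‖ ≤ ‖fderiv ℝ ψ ((ρ : ℂ) * e)‖ * ‖e‖ := ContinuousLinearMap.le_opNorm _ _
      _ = ‖fderiv ℝ ψ ((ρ : ℂ) * e)‖ := by rw [he, norm_rayDir, mul_one]
  change |g r - g w| ≤ ∫ ρ in w..r, ‖fderiv ℝ ψ ((ρ : ℂ) * e)‖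
  rw [← hftc]
  calc |∫ ρ in w..r, g' ρ| ≤ ∫ ρ in w..r, |g' ρ| := intervalIntegral.abs_integral_le_integral_abs hwr
    _ ≤ ∫ ρ in w..r, ‖fderiv ℝ ψ ((ρ : ℂ) * e)‖ :=
        intervalIntegral.integral_mono_on hwr (hg'c.abs.intervalIntegrable _ _) (hNc.intervalIntegrable _ _)
          fun ρ _ => hbound ρ

/-- Derivative of `ψ` along a circle: `d/dθ ψ(circleMap 0 ρ θ) = Dψ(circleMap 0 ρ θ)[circleMap 0 ρ θ · i]`. [folklore] -/
theorem hasDerivAt_comp_circleMap {ψ : ℂ → ℝ} (hψ : Differentiable ℝ ψ) (ρ θ : ℝ) :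
    HasDerivAt (fun θ : ℝ => ψ (circleMap 0 ρ θ))
      (fderiv ℝ ψ (circleMap 0 ρ θ) (circleMap 0 ρ θ * I)) θ :=
  (hψ _).hasFDerivAt.comp_hasDerivAt θ (hasDerivAt_circleMap 0 ρ θ)

/-- FTC along an arc: `|ψ(ρe^{ib}) − ψ(ρe^{ia})| ≤ ∫_a^b ρ ‖Dψ(ρ e^{iθ})‖ dθ` for `0 ≤ ρ`, `a ≤ b`. [folklore] -/
theorem abs_sub_le_integral_norm_fderiv_arc {ψ : ℂ → ℝ} (hψ : ContDiff ℝ 1 ψ) {ρ : ℝ} (hρ : 0 ≤ ρ)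
    {a b : ℝ} (hab : a ≤ b) :
    |ψ (circleMap 0 ρ b) - ψ (circleMap 0 ρ a)| ≤ ∫ θ in a..b, ρ * ‖fderiv ℝ ψ (circleMap 0 ρ θ)‖ := by
  set g : ℝ → ℝ := fun θ => ψ (circleMap 0 ρ θ) with hg
  set g' : ℝ → ℝ := fun θ => fderiv ℝ ψ (circleMap 0 ρ θ) (circleMap 0 ρ θ * I) with hg'
  have hψd : Differentiable ℝ ψ := hψ.differentiable one_ne_zero
  have hderiv : ∀ θ, HasDerivAt g (g' θ) θ := fun θ => hasDerivAt_comp_circleMap hψd ρ θ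
  have hcm : Continuous fun θ : ℝ => circleMap 0 ρ θ := continuous_circleMap 0 ρ
  have hDc : Continuous fun θ : ℝ => fderiv ℝ ψ (circleMap 0 ρ θ) := (hψ.continuous_fderiv one_ne_zero).comp hcm
  have hg'c : Continuous g' := hDc.clm_apply (hcm.mul continuous_const)
  have hNc : Continuous fun θ : ℝ => ρ * ‖fderiv ℝ ψ (circleMap 0 ρ θ)‖ := continuous_const.mul hDc.norm
  have hftc : ∫ θ in a..b, g' θ = g b - g a :=
    integral_eq_sub_of_hasDerivAt (fun θ _ => hderiv θ) (hg'c.intervalIntegrable _ _)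
  have hbound : ∀ θ, |g' θ| ≤ ρ * ‖fderiv ℝ ψ (circleMap 0 ρ θ)‖ := by
    intro θ
    rw [hg', ← Real.norm_eq_abs]
    calc ‖fderiv ℝ ψ (circleMap 0 ρ θ) (circleMap 0 ρ θ * I)‖
        ≤ ‖fderiv ℝ ψ (circleMap 0 ρ θ)‖ * ‖circleMap 0 ρ θ * I‖ := ContinuousLinearMap.le_opNorm _ _
      _ = ρ * ‖fderiv ℝ ψ (circleMap 0 ρ θ)‖ := by
          rw [norm_mul, norm_circleMap_zero, Complex.norm_I, mul_one, abs_of_nonneg hρ, mul_comm]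
  change |g b - g a| ≤ ∫ θ in a..b, ρ * ‖fderiv ℝ ψ (circleMap 0 ρ θ)‖
  rw [← hftc]
  calc |∫ θ in a..b, g' θ| ≤ ∫ θ in a..b, |g' θ| := intervalIntegral.abs_integral_le_integral_abs hab
    _ ≤ ∫ θ in a..b, ρ * ‖fderiv ℝ ψ (circleMap 0 ρ θ)‖ :=
        intervalIntegral.integral_mono_on hab (hg'c.abs.intervalIntegrable _ _) (hNc.intervalIntegrable _ _)
          fun θ _ => hbound θ

/-! ## §3 The mean capacity count of an annulus (Cauchy–Schwarz in the angle is `Literature.Analysis.ODE.sq_intervalIntegral_le`) -/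

/-- Continuity in the angle of the ray integrals `θ ↦ ∫_w^r G(ρ, θ) dρ` for a continuous `G`. [folklore] -/
theorem continuous_rayIntegral {G : ℝ → ℝ → ℝ} (hG : Continuous (uncurry G)) (w r : ℝ) :
    Continuous fun θ : ℝ => ∫ ρ in w..r, G ρ θ := by
  refine intervalIntegral.continuous_parametric_intervalIntegral_of_continuous' ?_ w r
  exact hG.comp (continuous_snd.prodMk continuous_fst)

/-- Step (3) of the mean count: the difference of two circular means is at most the angular average of the
ray lengths, `|m(w) − m(r)| ≤ (2π)⁻¹ ∫_0^{2π} ∫_w^r ‖Dψ(ρe^{iθ})‖ dρ dθ`. [folklore] -/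
theorem abs_circleAverage_sub_le {ψ : ℂ → ℝ} (hψ : ContDiff ℝ 1 ψ) {w r : ℝ} (hwr : w ≤ r) :
    |Real.circleAverage ψ 0 w - Real.circleAverage ψ 0 r| ≤
      (2 * π)⁻¹ * ∫ θ in (0 : ℝ)..2 * π, ∫ ρ in w..r, ‖fderiv ℝ ψ (circleMap 0 ρ θ)‖ := by
  have h2π : (0 : ℝ) ≤ 2 * π := by positivity
  have hcm : Continuous fun p : ℝ × ℝ => circleMap 0 p.1 p.2 := by unfold circleMap; fun_prop
  have hN : Continuous (uncurry fun ρ θ : ℝ => ‖fderiv ℝ ψ (circleMap 0 ρ θ)‖) :=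
    ((hψ.continuous_fderiv one_ne_zero).comp hcm).norm
  have hXc : Continuous fun θ : ℝ => ∫ ρ in w..r, ‖fderiv ℝ ψ (circleMap 0 ρ θ)‖ :=
    continuous_rayIntegral hN w r
  have hψc : Continuous ψ := hψ.continuous
  have hiw : IntervalIntegrable (fun θ => ψ (circleMap 0 w θ)) volume 0 (2 * π) :=
    (hψc.comp (continuous_circleMap 0 w)).intervalIntegrable _ _
  have hir : IntervalIntegrable (fun θ => ψ (circleMap 0 r θ)) volume 0 (2 * π) :=
    (hψc.comp (continuous_circleMap 0 r)).intervalIntegrable _ _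
  have hΔ : Real.circleAverage ψ 0 w - Real.circleAverage ψ 0 r =
      (2 * π)⁻¹ * ∫ θ in (0 : ℝ)..2 * π, (ψ (circleMap 0 w θ) - ψ (circleMap 0 r θ)) := by
    rw [Real.circleAverage_def, Real.circleAverage_def, smul_eq_mul, smul_eq_mul,
      intervalIntegral.integral_sub hiw hir]
    ring
  rw [hΔ, abs_mul, abs_of_pos (by positivity : (0 : ℝ) < (2 * π)⁻¹)]
  refine mul_le_mul_of_nonneg_left ?_ (by positivity)
  calc |∫ θ in (0 : ℝ)..2 * π, (ψ (circleMap 0 w θ) - ψ (circleMap 0 r θ))|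
      ≤ ∫ θ in (0 : ℝ)..2 * π, |ψ (circleMap 0 w θ) - ψ (circleMap 0 r θ)| :=
        intervalIntegral.abs_integral_le_integral_abs h2π
    _ ≤ ∫ θ in (0 : ℝ)..2 * π, ∫ ρ in w..r, ‖fderiv ℝ ψ (circleMap 0 ρ θ)‖ := by
        refine intervalIntegral.integral_mono_on h2π ((hiw.sub hir).abs) (hXc.intervalIntegrable _ _)
          fun θ _ => ?_
        rw [abs_sub_comm]
        exact abs_sub_le_integral_norm_fderiv_ray' hψ hwr θ

/-- Steps (2)+(4) of the mean count: `(∫_0^{2π} ∫_w^r ‖Dψ(ρe^{iθ})‖ dρ dθ)² ≤ 2π · log(r/w) · ∫_{w ≤ ‖z‖ ≤ r} ‖Dψ‖²`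
(weighted Cauchy–Schwarz along each ray, plain Cauchy–Schwarz in the angle, polar coordinates). [folklore] -/
theorem sq_integral_rayLength_le {ψ : ℂ → ℝ} (hψ : ContDiff ℝ 1 ψ) {w r : ℝ} (hw : 0 < w) (hwr : w ≤ r) :
    (∫ θ in (0 : ℝ)..2 * π, ∫ ρ in w..r, ‖fderiv ℝ ψ (circleMap 0 ρ θ)‖) ^ 2 ≤
      2 * π * (Real.log (r / w) * ∫ z in {z : ℂ | w ≤ ‖z‖ ∧ ‖z‖ ≤ r}, ‖fderiv ℝ ψ z‖ ^ 2) := by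
  have h2π : (0 : ℝ) ≤ 2 * π := by positivity
  have hFc : Continuous fun z => ‖fderiv ℝ ψ z‖ ^ 2 := (hψ.continuous_fderiv one_ne_zero).norm.pow 2
  have hcm : Continuous fun p : ℝ × ℝ => circleMap 0 p.1 p.2 := by unfold circleMap; fun_prop
  have hN : Continuous (uncurry fun ρ θ : ℝ => ‖fderiv ℝ ψ (circleMap 0 ρ θ)‖) :=
    ((hψ.continuous_fderiv one_ne_zero).comp hcm).norm
  have hH : Continuous (uncurry fun ρ θ : ℝ => ρ * ‖fderiv ℝ ψ (circleMap 0 ρ θ)‖ ^ 2) :=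
    continuous_fst.mul (hN.pow 2)
  have hXc : Continuous fun θ : ℝ => ∫ ρ in w..r, ‖fderiv ℝ ψ (circleMap 0 ρ θ)‖ :=
    continuous_rayIntegral hN w r
  have hhc : Continuous fun θ : ℝ => ∫ ρ in w..r, ρ * ‖fderiv ℝ ψ (circleMap 0 ρ θ)‖ ^ 2 :=
    continuous_rayIntegral hH w r
  -- polar coordinates
  rw [annulusIntegral_eq_integral_circleMap hFc hw hwr]
  -- ray by ray
  have hX2 : ∀ θ : ℝ, (∫ ρ in w..r, ‖fderiv ℝ ψ (circleMap 0 ρ θ)‖) ^ 2 ≤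
      Real.log (r / w) * ∫ ρ in w..r, ρ * ‖fderiv ℝ ψ (circleMap 0 ρ θ)‖ ^ 2 := by
    intro θ
    have hac : Continuous fun ρ : ℝ => ‖fderiv ℝ ψ (circleMap 0 ρ θ)‖ := by
      have h1 : Continuous fun ρ : ℝ => circleMap 0 ρ θ := by unfold circleMap; fun_prop
      exact ((hψ.continuous_fderiv one_ne_zero).comp h1).norm
    exact sq_integral_le_log_mul_integral_mul_sq hac hw hwr
  have hsum : ∫ θ in (0 : ℝ)..2 * π, (∫ ρ in w..r, ‖fderiv ℝ ψ (circleMap 0 ρ θ)‖) ^ 2 ≤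
      Real.log (r / w) * ∫ θ in (0 : ℝ)..2 * π, ∫ ρ in w..r, ρ * ‖fderiv ℝ ψ (circleMap 0 ρ θ)‖ ^ 2 := by
    rw [← intervalIntegral.integral_const_mul]
    exact intervalIntegral.integral_mono_on h2π ((hXc.pow 2).intervalIntegrable _ _)
      ((continuous_const.mul hhc).intervalIntegrable _ _) fun θ _ => hX2 θ
  -- Cauchy–Schwarz in the angle
  have hCS := Literature.Analysis.ODE.sq_intervalIntegral_le hXc h2π
  rw [sub_zero] at hCS
  exact hCS.trans (mul_le_mul_of_nonneg_left hsum h2π)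

/-- **MEAN LOG-CAPACITY OF A PLANAR ANNULUS.**  For `ψ ∈ C¹(ℂ, ℝ)`, `0 < w < r`, and the circular means
`m(ρ) = ⨍_{‖z‖ = ρ} ψ` (`Real.circleAverage ψ 0 ρ`):
`2π (m(w) − m(r))² / log(r/w) ≤ ∫_{w ≤ ‖z‖ ≤ r} ‖Dψ(z)‖² dz`.
(Ray FTC `|ψ(re^{iθ}) − ψ(we^{iθ})| ≤ ∫_w^r ‖Dψ‖`, the weighted Cauchy–Schwarz `(∫_w^r a)² ≤ log(r/w)∫_w^r ρa²`,
and Cauchy–Schwarz in the angle.)  This is the amplitude count `annulusEnergy_ge_amplitude` with pointwise boundary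
values replaced by circular means. [folklore (logarithmic capacity of an annulus)] -/
theorem annulusEnergy_ge_circleAverage_amplitude {ψ : ℂ → ℝ} (hψ : ContDiff ℝ 1 ψ) {w r : ℝ} (hw : 0 < w)
    (hwr : w < r) :
    2 * π * (Real.circleAverage ψ 0 w - Real.circleAverage ψ 0 r) ^ 2 / Real.log (r / w) ≤
      ∫ z in {z : ℂ | w ≤ ‖z‖ ∧ ‖z‖ ≤ r}, ‖fderiv ℝ ψ z‖ ^ 2 := by
  have hπ : 0 < π := Real.pi_pos
  have hΛpos : 0 < Real.log (r / w) := Real.log_pos ((one_lt_div hw).2 hwr)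
  have hA := abs_circleAverage_sub_le hψ hwr.le
  have hB := sq_integral_rayLength_le hψ hw hwr.le
  -- name the four real numbers and finish with algebra
  generalize Real.circleAverage ψ 0 w - Real.circleAverage ψ 0 r = Δ at hA ⊢
  generalize (∫ θ in (0 : ℝ)..2 * π, ∫ ρ in w..r, ‖fderiv ℝ ψ (circleMap 0 ρ θ)‖) = SX at hA hB
  generalize (∫ z in {z : ℂ | w ≤ ‖z‖ ∧ ‖z‖ ≤ r}, ‖fderiv ℝ ψ z‖ ^ 2) = E at hB ⊢
  generalize Real.log (r / w) = Λ at hΛpos hB ⊢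
  have h1 : 2 * π * |Δ| ≤ SX := by
    have := mul_le_mul_of_nonneg_left hA (by positivity : (0 : ℝ) ≤ 2 * π)
    rwa [← mul_assoc, mul_inv_cancel₀ (by positivity : (2 : ℝ) * π ≠ 0), one_mul] at this
  have h2 : (2 * π * |Δ|) ^ 2 ≤ SX ^ 2 := pow_le_pow_left₀ (by positivity) h1 2
  have h4 : (2 * π * |Δ|) ^ 2 = (2 * π) * (2 * π * Δ ^ 2) := by rw [mul_pow, sq_abs]; ring
  rw [div_le_iff₀ hΛpos]
  nlinarith [h2, hB, h4, hπ]

/-! ## §4 The oscillation count on one circle -/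

/-- **Two values on a circle cost energy.**  For `ψ ∈ C¹(ℂ, ℝ)`, `ρ > 0` and two angles with
`ψ(ρe^{iθ₁}) − ψ(ρe^{iθ₂}) ≥ D ≥ 0`:  `2D²/(πρ) ≤ ρ ∫_0^{2π} ‖Dψ(ρe^{iθ})‖² dθ`
(the two complementary arcs each carry variation `≥ D`, so `2D ≤ ρ∫_0^{2π}‖Dψ‖`, then Cauchy–Schwarz). [folklore] -/
theorem circleEnergy_ge_of_two_values {ψ : ℂ → ℝ} (hψ : ContDiff ℝ 1 ψ) {ρ : ℝ} (hρ : 0 < ρ) {θ₁ θ₂ D : ℝ}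
    (hD0 : 0 ≤ D) (hD : D ≤ ψ (circleMap 0 ρ θ₁) - ψ (circleMap 0 ρ θ₂)) :
    2 * D ^ 2 / (π * ρ) ≤ ρ * ∫ θ in (0 : ℝ)..2 * π, ‖fderiv ℝ ψ (circleMap 0 ρ θ)‖ ^ 2 := by
  have hπ : 0 < π := Real.pi_pos
  have h2π : (0 : ℝ) < 2 * π := by positivity
  -- the angular speed bound `Y = ρ ‖Dψ‖`, continuous and `2π`-periodic
  set Y : ℝ → ℝ := fun θ => ρ * ‖fderiv ℝ ψ (circleMap 0 ρ θ)‖ with hY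
  have hDc : Continuous fun θ : ℝ => fderiv ℝ ψ (circleMap 0 ρ θ) :=
    (hψ.continuous_fderiv one_ne_zero).comp (continuous_circleMap 0 ρ)
  have hYc : Continuous Y := continuous_const.mul hDc.norm
  have hYper : Periodic Y (2 * π) := fun θ => by simp only [hY, (periodic_circleMap 0 ρ) θ]
  -- move `θ₂` into the period window `[θ₁, θ₁ + 2π)`
  obtain ⟨θ₂', hmem, heq⟩ := (periodic_circleMap 0 ρ).exists_mem_Ico h2π θ₂ θ₁
  have hv2 : ψ (circleMap 0 ρ θ₂') = ψ (circleMap 0 ρ θ₂) := by rw [heq]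
  have hv1 : ψ (circleMap 0 ρ (θ₁ + 2 * π)) = ψ (circleMap 0 ρ θ₁) := by rw [(periodic_circleMap 0 ρ) θ₁]
  -- the two arcs
  have harc1 : D ≤ ∫ θ in θ₁..θ₂', Y θ := by
    have h := abs_sub_le_integral_norm_fderiv_arc hψ hρ.le hmem.1
    rw [hv2] at h
    have : D ≤ |ψ (circleMap 0 ρ θ₂) - ψ (circleMap 0 ρ θ₁)| := by
      rw [abs_sub_comm]; exact hD.trans (le_abs_self _)
    exact this.trans h
  have harc2 : D ≤ ∫ θ in θ₂'..θ₁ + 2 * π, Y θ := by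
    have h := abs_sub_le_integral_norm_fderiv_arc hψ hρ.le hmem.2.le
    rw [hv1, hv2] at h
    exact (hD.trans (le_abs_self _)).trans h
  have hfull : ∫ θ in θ₁..θ₁ + 2 * π, Y θ = ∫ θ in (0 : ℝ)..2 * π, Y θ := by
    have h := hYper.intervalIntegral_add_eq θ₁ 0
    rw [zero_add] at h
    exact h
  have hsplit : ∫ θ in θ₁..θ₁ + 2 * π, Y θ = (∫ θ in θ₁..θ₂', Y θ) + ∫ θ in θ₂'..θ₁ + 2 * π, Y θ :=
    (intervalIntegral.integral_add_adjacent_intervals (hYc.intervalIntegrable _ _)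
      (hYc.intervalIntegrable _ _)).symm
  have h2D : 2 * D ≤ ∫ θ in (0 : ℝ)..2 * π, Y θ := by
    rw [← hfull, hsplit]; linarith [harc1, harc2]
  -- Cauchy–Schwarz
  have hCS : (∫ θ in (0 : ℝ)..2 * π, Y θ) ^ 2 ≤ (2 * π - 0) * ∫ θ in (0 : ℝ)..2 * π, Y θ ^ 2 :=
    Literature.Analysis.ODE.sq_intervalIntegral_le hYc h2π.le
  rw [sub_zero] at hCS
  have hY2 : ∫ θ in (0 : ℝ)..2 * π, Y θ ^ 2 = ρ ^ 2 * ∫ θ in (0 : ℝ)..2 * π, ‖fderiv ℝ ψ (circleMap 0 ρ θ)‖ ^ 2 := by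
    rw [← intervalIntegral.integral_const_mul]
    refine intervalIntegral.integral_congr fun θ _ => ?_
    simp only [hY]; ring
  have h4 : (2 * D) ^ 2 ≤ (∫ θ in (0 : ℝ)..2 * π, Y θ) ^ 2 := pow_le_pow_left₀ (by positivity) h2D 2
  set I := ∫ θ in (0 : ℝ)..2 * π, ‖fderiv ℝ ψ (circleMap 0 ρ θ)‖ ^ 2 with hI
  rw [div_le_iff₀ (by positivity : (0 : ℝ) < π * ρ)]
  rw [hY2] at hCS
  nlinarith [h4, hCS, hπ, hρ]

end Summit.NavierStokesRegularity.NavierStokesRegularity.Theorems.PowerGaugeEulerLiouville.Condenser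

end
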